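import Literature.MathematicalPhysics.QuantumLattice.HubbardTTPrimeApexRow
import Literature.MathematicalPhysics.QuantumLattice.TorusSectorGibbsMixture
import HarnessLib

/-!
# The GROUND → THERMAL apex row: a `T = 0` one-body floor at the source `A = (t'_A, U_A)` is a THERMAL
# one-body floor at every target `P = (t'_P, U_P)`, `U_P > U_A`, on the apex ray through `A`, at EVERY
# inverse temperature `β`, at the explicit entropy price `U_A·s_∞(n)/(β(U_P − U_A))`

Family `hubbard` (topic `MathematicalPhysics/QuantumLattice`); the mixed-class companion of the `T = 0` apex row
`HubbardTTPrimeApexRow` (two ground states) and of the thermal apex row `HubbardTTPrimeApexRowThermal` (two Gibbs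
states on a ray `βU = const`). Written for the `T > 0` leg of the Hubbard material-oracle programme (the phase map's
cells are `T × couplings`; seat `hubbard-downfold-unc-2`, `prover-hubbard-downfold-unc-2-g18-0`).

THE OBSERVATION. Coordinates `e_{Φ(t,s,U)}(ω) = t·K₁(ω) + s·K₂(ω) + U·D(ω)` (`meanEnergy_hubbardTTPrime_eq_coords`). Let
`ω_A` be a torus limit of unit `(rectN n, S^z = 0)`-sector GROUND states of `H(t,t'_A,U_A)` and `ω_P` a torus limit of the
canonical sector GIBBS states of `H(t,t'_P,U_P)` at inverse temperature `β > 0`, same density `n`, `0 ≤ U_A < U_P`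
(the two limits may run along DIFFERENT sequences of tori: everything goes through the ground-state energy density
`e(·) = energyDensityTT'`). Two inequalities hold:
* (CUT)  `e_{Φ(A)}(ω_A) = e(t,t'_A,U_A,n) ≤ e_{Φ(A)}(ω_P)` — the ground state realises `e(A)`
  (`IsTorusLimitOf.meanEnergy_hubbardTTPrime_eq_energyDensityTT'`), which no translation-invariant state of density `n`,
  in particular the thermal one, undercuts (`IsTorusLimitOfMixture.energyDensityTT'_le_meanEnergy_of_sectorGibbs`);
* (CAP)  `e_{Φ(P)}(ω_P) ≤ e(t,t'_P,U_P,n) + s_∞(n)/β ≤ e_{Φ(P)}(ω_A) + s_∞(n)/β`, `s_∞(n) = 2·H_b(n/2) ≤ log 4` — the universal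
  energy–entropy cap of a thermal torus limit (`E ≤ E₀ + T·S_max`, Gibbs variational principle at the ground state plus
  `S ≤ log dim`; `IsTorusLimitOfMixture.meanEnergy_hubbardTTPrime_le_energyDensityTT'_add_binEntropy_div`) followed by the
  variational inequality for the unit fixed-density vectors behind `ω_A`
  (`IsTorusLimitOf.energyDensityTT'_le_meanEnergy_hubbardTTPrime`).
The combination `U_P·(CUT) + U_A·(CAP)` cancels the double occupancy `D` EXACTLY as in the `T = 0` apex row and leaves

  `e_{Φ(t,κ,0)}(ω_A) ≤ e_{Φ(t,κ,0)}(ω_P) + U_A·s_∞(n)/(β·(U_P − U_A))`,   `κ = (U_P t'_A − U_A t'_P)/(U_P − U_A)`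

(`κ` = the `t'`-intercept at `U = 0` of the line through `A` and `P`). Reading: a certified `T = 0` FLOOR on the `κ`-hopping
energy on the ground-state class at `A` — the shape of every stiffness certificate of record — is a floor on the THERMAL
class at `P` at every temperature, minus `T × (entropy bound) × U_A/(U_P − U_A)`; equivalently a `T = 0` stiffness-type CEILING
flows from `A` up the ray to every hotter target. No thermal certificate is used anywhere; the price vanishes linearly as
`T → 0` and is the only loss. §1 is the two-state algebra with a slack `δ` on the (CAP) side; §2 the torus-limit row; §3 the
«for every source ground state ⇒ for every target thermal state» packaging (compactness gives a source limit) and the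
doubled-hopping / `t' = 0` special cases the stiffness consumer needs.

HONEST SCOPE: transport of one-sided bounds only; nothing toward smaller `U`, nothing at `U_P = U_A` (the price diverges as
`U_P ↓ U_A`); the entropy bound is the crude `log dim` one (no low-temperature improvement is claimed); no certificate, no
number, no phase sentence. The half-filling hinge `t'K₂ ≤ 0` for thermal states is NOT proved or used here.

## Mathlib / tree search
REUSED (by name, see above) the `T = 0` apex algebra pattern of `HubbardTTPrimeApexRow` §1–§2, the thermal toolkit of
`TorusSectorGibbsMixture` §3, `exists_isTorusLimitOf_sectorGroundState_TT'`. `lean search 'groundState.*[Tt]hermal|GroundToThermal|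
apex.*entropy'`: nothing; the tree's mixed `T = 0`/`T > 0` row is hubbard-tc's coupling dilution (Summits
`Observables/StiffnessThermalCouplingDilution`: a thermal energy CAP at the target + a ground-state FLOOR at a smaller coupling, in
energy coordinates) — the present row takes the SOURCE's one-body word instead of energies and needs no thermal input.

## References
* D. Ruelle, *Statistical Mechanics: Rigorous Results* (1969), §2.5 (Gibbs variational principle; `E ≤ E₀ + T log dim`), §3.4.
  [cite: Ruelle1969, §2.5]
* R. B. Israel, *Convexity in the Theory of Lattice Gases* (1979), Lemma II.3.1. [cite: Israel1979, Lemma II.3.1]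
* T. Koma, H. Tasaki, J. Stat. Phys. 76 (1994) 745, §1 (conjugate observables of linear couplings). [cite: KomaTasaki1994, §1]
* R. B. Griffiths, J. Math. Phys. 7 (1966) 1215, §II. [cite: Griffiths1966, §II]
-/

noncomputable section

namespace Literature.MathematicalPhysics.QuantumLattice

open Matrix Finset HubbardWave0 Literature.Probability.LatticeModels ThermodynamicLimit
open _root_.Filter
open scoped _root_.Topology ComplexOrder BigOperators

namespace InfVolFermionState

/-! ### §1 The apex row with a slack on one side, every pair of states -/

/-- **Apex row with slack, every pair of states.** Two states `ωP, ωA`, couplings `A = (t, t'_A, U_A)`, `P = (t, t'_P, U_P)` with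
`0 ≤ U_A`, `0 ≤ U_P`, the cross inequality at `A` `e_{Φ(A)}(ωA) ≤ e_{Φ(A)}(ωP)` and the cross inequality at `P` WITH SLACK `δ`:
`e_{Φ(P)}(ωP) ≤ e_{Φ(P)}(ωA) + δ`. Then
`(U_P − U_A)·t·K₁(ωA) + (U_P t'_A − U_A t'_P)·K₂(ωA) ≤ (U_P − U_A)·t·K₁(ωP) + (U_P t'_A − U_A t'_P)·K₂(ωP) + U_A·δ` — the combination
`U_P·(at A) + U_A·(at P)`, in which the on-site coordinate cancels. [cite: KomaTasaki1994, §1] [cite: Griffiths1966, §II] -/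
theorem apex_le_of_cross_variational_slack (ωP ωA : InfVolFermionState 2) {t t'A UA t'P UP δ : ℝ} (hUA : 0 ≤ UA)
    (hUP : 0 ≤ UP)
    (hP : ωP.meanEnergy (hubbardTTPrimeFermionInteraction t t'P UP) 1 ≤
      ωA.meanEnergy (hubbardTTPrimeFermionInteraction t t'P UP) 1 + δ)
    (hA : ωA.meanEnergy (hubbardTTPrimeFermionInteraction t t'A UA) 1 ≤
      ωP.meanEnergy (hubbardTTPrimeFermionInteraction t t'A UA) 1) :
    (UP - UA) * t * ωA.meanEnergy (hubbardTTPrimeFermionInteraction 1 0 0) 1 +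
        (UP * t'A - UA * t'P) * ωA.meanEnergy (hubbardTTPrimeFermionInteraction 0 1 0) 1 ≤
      (UP - UA) * t * ωP.meanEnergy (hubbardTTPrimeFermionInteraction 1 0 0) 1 +
        (UP * t'A - UA * t'P) * ωP.meanEnergy (hubbardTTPrimeFermionInteraction 0 1 0) 1 + UA * δ := by
  rw [ωP.meanEnergy_hubbardTTPrime_eq_coords t t'P UP, ωA.meanEnergy_hubbardTTPrime_eq_coords t t'P UP] at hP
  rw [ωA.meanEnergy_hubbardTTPrime_eq_coords t t'A UA, ωP.meanEnergy_hubbardTTPrime_eq_coords t t'A UA] at hA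
  have h1 := mul_le_mul_of_nonneg_left hA hUP
  have h2 := mul_le_mul_of_nonneg_left hP hUA
  nlinarith [h1, h2]

/-- **One-body energy at the apex hopping, with slack** (`0 ≤ U_A < U_P`): under the cross inequality at `A` and the cross
inequality at `P` with slack `δ`, `e_{Φ(t,κ,0)}(ωA) ≤ e_{Φ(t,κ,0)}(ωP) + U_A·δ/(U_P − U_A)`, `κ = (U_P t'_A − U_A t'_P)/(U_P − U_A)`.
[cite: KomaTasaki1994, §1] [cite: Griffiths1966, §II] -/
theorem meanEnergy_apexHopping_le_of_cross_variational_slack (ωP ωA : InfVolFermionState 2)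
    {t t'A UA t'P UP δ : ℝ} (hUA : 0 ≤ UA) (hU : UA < UP)
    (hP : ωP.meanEnergy (hubbardTTPrimeFermionInteraction t t'P UP) 1 ≤
      ωA.meanEnergy (hubbardTTPrimeFermionInteraction t t'P UP) 1 + δ)
    (hA : ωA.meanEnergy (hubbardTTPrimeFermionInteraction t t'A UA) 1 ≤
      ωP.meanEnergy (hubbardTTPrimeFermionInteraction t t'A UA) 1) :
    ωA.meanEnergy (hubbardTTPrimeFermionInteraction t ((UP * t'A - UA * t'P) / (UP - UA)) 0) 1 ≤
      ωP.meanEnergy (hubbardTTPrimeFermionInteraction t ((UP * t'A - UA * t'P) / (UP - UA)) 0) 1 +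
        UA * δ / (UP - UA) := by
  have hd : 0 < UP - UA := sub_pos.2 hU
  have h := apex_le_of_cross_variational_slack ωP ωA hUA (hUA.trans hU.le) hP hA
  rw [ωA.meanEnergy_hubbardTTPrime_eq_coords, ωP.meanEnergy_hubbardTTPrime_eq_coords]
  simp only [zero_mul, add_zero]
  rw [← sub_nonneg] at h ⊢
  have hid : t * ωP.meanEnergy (hubbardTTPrimeFermionInteraction 1 0 0) 1 +
        (UP * t'A - UA * t'P) / (UP - UA) * ωP.meanEnergy (hubbardTTPrimeFermionInteraction 0 1 0) 1 +
        UA * δ / (UP - UA) -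
      (t * ωA.meanEnergy (hubbardTTPrimeFermionInteraction 1 0 0) 1 +
        (UP * t'A - UA * t'P) / (UP - UA) * ωA.meanEnergy (hubbardTTPrimeFermionInteraction 0 1 0) 1) =
      (UP - UA)⁻¹ * ((UP - UA) * t * ωP.meanEnergy (hubbardTTPrimeFermionInteraction 1 0 0) 1 +
        (UP * t'A - UA * t'P) * ωP.meanEnergy (hubbardTTPrimeFermionInteraction 0 1 0) 1 + UA * δ -
        ((UP - UA) * t * ωA.meanEnergy (hubbardTTPrimeFermionInteraction 1 0 0) 1 +
          (UP * t'A - UA * t'P) * ωA.meanEnergy (hubbardTTPrimeFermionInteraction 0 1 0) 1)) := by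
    field_simp
  rw [hid]
  exact mul_nonneg (inv_pos.2 hd).le h

/-- **Doubled-hopping form with slack.** `0 ≤ U_A < U_P` and `A` on the segment from the apex `(2t'_P, 0)` to `P`:
`U_P·t'_A = (2U_P − U_A)·t'_P`. Under the cross inequality at `A` and the slack-`δ` cross inequality at `P`:
`e_{Φ(t,2t'_P,0)}(ωA) ≤ e_{Φ(t,2t'_P,0)}(ωP) + U_A·δ/(U_P − U_A)`. [cite: KomaTasaki1994, §1] [cite: ScalapinoWhiteZhang1993, §II] -/
theorem meanEnergy_twice_tPrime_le_of_cross_variational_slack_of_apex (ωP ωA : InfVolFermionState 2)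
    {t t'A UA t'P UP δ : ℝ} (hUA : 0 ≤ UA) (hU : UA < UP) (hapex : UP * t'A = (2 * UP - UA) * t'P)
    (hP : ωP.meanEnergy (hubbardTTPrimeFermionInteraction t t'P UP) 1 ≤
      ωA.meanEnergy (hubbardTTPrimeFermionInteraction t t'P UP) 1 + δ)
    (hA : ωA.meanEnergy (hubbardTTPrimeFermionInteraction t t'A UA) 1 ≤
      ωP.meanEnergy (hubbardTTPrimeFermionInteraction t t'A UA) 1) :
    ωA.meanEnergy (hubbardTTPrimeFermionInteraction t (2 * t'P) 0) 1 ≤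
      ωP.meanEnergy (hubbardTTPrimeFermionInteraction t (2 * t'P) 0) 1 + UA * δ / (UP - UA) := by
  have hd : 0 < UP - UA := sub_pos.2 hU
  have e : (UP * t'A - UA * t'P) / (UP - UA) = 2 * t'P := by
    rw [div_eq_iff hd.ne', hapex]
    ring
  have h := meanEnergy_apexHopping_le_of_cross_variational_slack ωP ωA hUA hU hP hA
  rwa [e] at h

/-! ### §2 Torus limits: ground states at the source, Gibbs states at the target -/

variable {t n : ℝ}

/-- **THE GROUND → THERMAL APEX ROW (torus limits, any tori on either side).** `0 ≤ n < 2`, `0 ≤ U_A < U_P`, `0 < β`,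
`κ = (U_P t'_A − U_A t'_P)/(U_P − U_A)`; `ω_A` a torus limit of unit `(rectN n, S^z = 0)`-sector ground states of `H(t,t'_A,U_A)`,
`ω_P` a torus limit of the canonical sector Gibbs states of `H(t,t'_P,U_P)` at `β`. Then
`e_{Φ(t,κ,0)}(ω_A) ≤ e_{Φ(t,κ,0)}(ω_P) + U_A·(2H_b(n/2)/β)/(U_P − U_A)`: (CUT) at `A` and (CAP) at `P`
(`e_{Φ(P)}(ω_P) ≤ e(P) + 2H_b(n/2)/β ≤ e_{Φ(P)}(ω_A) + 2H_b(n/2)/β`) combined with weights `U_P`, `U_A`.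
[cite: Ruelle1969, §2.5] [cite: Israel1979, Lemma II.3.1] [cite: KomaTasaki1994, §1] -/
theorem IsTorusLimitOf.meanEnergy_apexHopping_le_thermal_add_of_groundState (t t'A t'P : ℝ) {UA UP : ℝ}
    (hUA : 0 ≤ UA) (hU : UA < UP) (hn0 : 0 ≤ n) (hn2 : n < 2) {β : ℝ} (hβ : 0 < β)
    {ωA ωP : InfVolFermionState 2} {ψA : ∀ L, Fock (Orb (FermionTorus 2 L))} {LsA LsP : ℕ → ℕ}
    (hA : ωA.IsTorusLimitOf ψA LsA) (hLsA : Tendsto LsA atTop atTop)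
    (hψA : ∀ j, IsGroundStateInSector (hubbardTorusTT' (LsA j) t t'A UA) (rectN n (LsA j)) 0 (ψA (LsA j)))
    (h1A : ∀ j, star (ψA (LsA j)) ⬝ᵥ ψA (LsA j) = 1)
    (hP : ωP.IsTorusLimitOfMixture (sectorGibbsCount n) (fun L => sectorGibbsWeightTT' β t t'P UP n L)
      (fun L => sectorGibbsVectorTT' t t'P UP n L) LsP)
    (hLsP : Tendsto LsP atTop atTop) :
    ωA.meanEnergy (hubbardTTPrimeFermionInteraction t ((UP * t'A - UA * t'P) / (UP - UA)) 0) 1 ≤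
      ωP.meanEnergy (hubbardTTPrimeFermionInteraction t ((UP * t'A - UA * t'P) / (UP - UA)) 0) 1 +
        UA * (2 * Real.binEntropy (n / 2) / β) / (UP - UA) := by
  have hUP : 0 ≤ UP := hUA.trans hU.le
  have hNA : ∀ j, IsNParticle (rectN n (LsA j)) (ψA (LsA j)) := fun j =>
    ((mem_szSector_iff _ _ _).1 (hψA j).1).1
  -- (CUT) at `A`: the ground state realises `e(A)`, the thermal state does not undercut it
  have hcutA : ωA.meanEnergy (hubbardTTPrimeFermionInteraction t t'A UA) 1 ≤
      ωP.meanEnergy (hubbardTTPrimeFermionInteraction t t'A UA) 1 := by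
    rw [hA.meanEnergy_hubbardTTPrime_eq_energyDensityTT' t t'A hUA hn0 hn2 hLsA hψA h1A]
    exact hP.energyDensityTT'_le_meanEnergy_of_sectorGibbs t t'P UP hn0 hn2 β hLsP t'A hUA
  -- (CAP) at `P`: `e_{Φ(P)}(ω_P) ≤ e(P) + s_∞/β ≤ e_{Φ(P)}(ω_A) + s_∞/β`
  have hcapP : ωP.meanEnergy (hubbardTTPrimeFermionInteraction t t'P UP) 1 ≤
      ωA.meanEnergy (hubbardTTPrimeFermionInteraction t t'P UP) 1 + 2 * Real.binEntropy (n / 2) / β := by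
    have h1 := hP.meanEnergy_hubbardTTPrime_le_energyDensityTT'_add_binEntropy_div t t'P hUP hn0 hn2 hβ hLsP
    have h2 := hA.energyDensityTT'_le_meanEnergy_hubbardTTPrime t t'P hUP hn0 hn2 hLsA hNA h1A
    linarith
  exact meanEnergy_apexHopping_le_of_cross_variational_slack ωP ωA hUA hU hcapP hcutA

/-- **The same with the density-free entropy constant `log 4`** (`2H_b(n/2) ≤ log 4`):
`e_{Φ(t,κ,0)}(ω_A) ≤ e_{Φ(t,κ,0)}(ω_P) + U_A·(log 4/β)/(U_P − U_A)`. [cite: Ruelle1969, §2.5] [cite: KomaTasaki1994, §1] -/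
theorem IsTorusLimitOf.meanEnergy_apexHopping_le_thermal_add_log_four_of_groundState (t t'A t'P : ℝ) {UA UP : ℝ}
    (hUA : 0 ≤ UA) (hU : UA < UP) (hn0 : 0 ≤ n) (hn2 : n < 2) {β : ℝ} (hβ : 0 < β)
    {ωA ωP : InfVolFermionState 2} {ψA : ∀ L, Fock (Orb (FermionTorus 2 L))} {LsA LsP : ℕ → ℕ}
    (hA : ωA.IsTorusLimitOf ψA LsA) (hLsA : Tendsto LsA atTop atTop)
    (hψA : ∀ j, IsGroundStateInSector (hubbardTorusTT' (LsA j) t t'A UA) (rectN n (LsA j)) 0 (ψA (LsA j)))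
    (h1A : ∀ j, star (ψA (LsA j)) ⬝ᵥ ψA (LsA j) = 1)
    (hP : ωP.IsTorusLimitOfMixture (sectorGibbsCount n) (fun L => sectorGibbsWeightTT' β t t'P UP n L)
      (fun L => sectorGibbsVectorTT' t t'P UP n L) LsP)
    (hLsP : Tendsto LsP atTop atTop) :
    ωA.meanEnergy (hubbardTTPrimeFermionInteraction t ((UP * t'A - UA * t'P) / (UP - UA)) 0) 1 ≤
      ωP.meanEnergy (hubbardTTPrimeFermionInteraction t ((UP * t'A - UA * t'P) / (UP - UA)) 0) 1 +
        UA * (Real.log 4 / β) / (UP - UA) := by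
  have hUP : 0 ≤ UP := hUA.trans hU.le
  have hNA : ∀ j, IsNParticle (rectN n (LsA j)) (ψA (LsA j)) := fun j =>
    ((mem_szSector_iff _ _ _).1 (hψA j).1).1
  have hcutA : ωA.meanEnergy (hubbardTTPrimeFermionInteraction t t'A UA) 1 ≤
      ωP.meanEnergy (hubbardTTPrimeFermionInteraction t t'A UA) 1 := by
    rw [hA.meanEnergy_hubbardTTPrime_eq_energyDensityTT' t t'A hUA hn0 hn2 hLsA hψA h1A]
    exact hP.energyDensityTT'_le_meanEnergy_of_sectorGibbs t t'P UP hn0 hn2 β hLsP t'A hUA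
  have hcapP : ωP.meanEnergy (hubbardTTPrimeFermionInteraction t t'P UP) 1 ≤
      ωA.meanEnergy (hubbardTTPrimeFermionInteraction t t'P UP) 1 + Real.log 4 / β := by
    have h1 := hP.meanEnergy_hubbardTTPrime_le_energyDensityTT'_add_log_four_div t t'P hUP hn0 hn2 hβ hLsP
    have h2 := hA.energyDensityTT'_le_meanEnergy_hubbardTTPrime t t'P hUP hn0 hn2 hLsA hNA h1A
    linarith
  exact meanEnergy_apexHopping_le_of_cross_variational_slack ωP ωA hUA hU hcapP hcutA

/-! ### §3 «Every source ground state ⇒ every target thermal state», and the special rays -/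

/-- **A `T = 0` FLOOR on the `κ`-hopping energy certified on the ground-state class at the SOURCE holds, minus the entropy price,
on the thermal class at the TARGET.** `0 ≤ n < 2`, `0 ≤ U_A < U_P`, `0 < β`, `κ = (U_P t'_A − U_A t'_P)/(U_P − U_A)`. If
`ℓ ≤ e_{Φ(t,κ,0)}(ω_A)` for EVERY torus limit `ω_A` of unit sector ground states of `H(t,t'_A,U_A)` at density `n` (the shape of a
`T = 0` one-body / f-sum word), then `ℓ − U_A·(2H_b(n/2)/β)/(U_P − U_A) ≤ e_{Φ(t,κ,0)}(ω_P)` for every torus limit `ω_P` of the canonical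
sector Gibbs states of `H(t,t'_P,U_P)` at `(β, n)` (a source limit exists by compactness, `exists_isTorusLimitOf_sectorGroundState_TT'`).
Reading: a certified `T = 0` CEILING `−e_{Φ(t,κ,0)} ≤ −ℓ` at `A` is the THERMAL ceiling `−ℓ + U_A·2H_b(n/2)/(β(U_P − U_A))` at `P`.
[cite: Ruelle1969, §2.5] [cite: KomaTasaki1994, §1] -/
theorem IsTorusLimitOfMixture.le_meanEnergy_apexHopping_thermal_of_forall_groundSource (t t'A t'P : ℝ)
    {UA UP : ℝ} (hUA : 0 ≤ UA) (hU : UA < UP) (hn0 : 0 ≤ n) (hn2 : n < 2) {β : ℝ} (hβ : 0 < β) {ℓ : ℝ}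
    (hℓ : ∀ (ωA : InfVolFermionState 2) (LsA : ℕ → ℕ) (ψA : ∀ L, Fock (Orb (FermionTorus 2 L))),
      Tendsto LsA atTop atTop →
      (∀ j, IsGroundStateInSector (hubbardTorusTT' (LsA j) t t'A UA) (rectN n (LsA j)) 0 (ψA (LsA j))) →
      (∀ j, star (ψA (LsA j)) ⬝ᵥ ψA (LsA j) = 1) → ωA.IsTorusLimitOf ψA LsA →
      ℓ ≤ ωA.meanEnergy (hubbardTTPrimeFermionInteraction t ((UP * t'A - UA * t'P) / (UP - UA)) 0) 1)
    {ωP : InfVolFermionState 2} {LsP : ℕ → ℕ}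
    (hP : ωP.IsTorusLimitOfMixture (sectorGibbsCount n) (fun L => sectorGibbsWeightTT' β t t'P UP n L)
      (fun L => sectorGibbsVectorTT' t t'P UP n L) LsP)
    (hLsP : Tendsto LsP atTop atTop) :
    ℓ - UA * (2 * Real.binEntropy (n / 2) / β) / (UP - UA) ≤
      ωP.meanEnergy (hubbardTTPrimeFermionInteraction t ((UP * t'A - UA * t'P) / (UP - UA)) 0) 1 := by
  obtain ⟨ψA, φ, ωA, hφ, hψA, hψA1, hωA, -, -, -⟩ :=
    exists_isTorusLimitOf_sectorGroundState_TT' t t'A UA hn0 hn2.le (Ls := id) tendsto_id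
  have hLφ : Tendsto (id ∘ φ : ℕ → ℕ) atTop atTop := tendsto_id.comp hφ.tendsto_atTop
  have hrow := IsTorusLimitOf.meanEnergy_apexHopping_le_thermal_add_of_groundState t t'A t'P hUA hU hn0 hn2 hβ
    hωA hLφ (fun j => hψA _) (fun j => hψA1 _) hP hLsP
  have hsrc := hℓ ωA (id ∘ φ) ψA hLφ (fun j => hψA _) (fun j => hψA1 _) hωA
  linarith

/-- **The `log 4` edition of the packaged row**: source floor `ℓ` on the ground-state class at `A` ⇒
`ℓ − U_A·(log 4/β)/(U_P − U_A) ≤ e_{Φ(t,κ,0)}(ω_P)` on the thermal class at `P`. [cite: Ruelle1969, §2.5] [cite: KomaTasaki1994, §1] -/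
theorem IsTorusLimitOfMixture.le_meanEnergy_apexHopping_thermal_of_forall_groundSource_log_four (t t'A t'P : ℝ)
    {UA UP : ℝ} (hUA : 0 ≤ UA) (hU : UA < UP) (hn0 : 0 ≤ n) (hn2 : n < 2) {β : ℝ} (hβ : 0 < β) {ℓ : ℝ}
    (hℓ : ∀ (ωA : InfVolFermionState 2) (LsA : ℕ → ℕ) (ψA : ∀ L, Fock (Orb (FermionTorus 2 L))),
      Tendsto LsA atTop atTop →
      (∀ j, IsGroundStateInSector (hubbardTorusTT' (LsA j) t t'A UA) (rectN n (LsA j)) 0 (ψA (LsA j))) →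
      (∀ j, star (ψA (LsA j)) ⬝ᵥ ψA (LsA j) = 1) → ωA.IsTorusLimitOf ψA LsA →
      ℓ ≤ ωA.meanEnergy (hubbardTTPrimeFermionInteraction t ((UP * t'A - UA * t'P) / (UP - UA)) 0) 1)
    {ωP : InfVolFermionState 2} {LsP : ℕ → ℕ}
    (hP : ωP.IsTorusLimitOfMixture (sectorGibbsCount n) (fun L => sectorGibbsWeightTT' β t t'P UP n L)
      (fun L => sectorGibbsVectorTT' t t'P UP n L) LsP)
    (hLsP : Tendsto LsP atTop atTop) :
    ℓ - UA * (Real.log 4 / β) / (UP - UA) ≤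
      ωP.meanEnergy (hubbardTTPrimeFermionInteraction t ((UP * t'A - UA * t'P) / (UP - UA)) 0) 1 := by
  obtain ⟨ψA, φ, ωA, hφ, hψA, hψA1, hωA, -, -, -⟩ :=
    exists_isTorusLimitOf_sectorGroundState_TT' t t'A UA hn0 hn2.le (Ls := id) tendsto_id
  have hLφ : Tendsto (id ∘ φ : ℕ → ℕ) atTop atTop := tendsto_id.comp hφ.tendsto_atTop
  have hrow := IsTorusLimitOf.meanEnergy_apexHopping_le_thermal_add_log_four_of_groundState t t'A t'P hUA hU hn0 hn2
    hβ hωA hLφ (fun j => hψA _) (fun j => hψA1 _) hP hLsP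
  have hsrc := hℓ ωA (id ∘ φ) ψA hLφ (fun j => hψA _) (fun j => hψA1 _) hωA
  linarith

/-- **Doubled-hopping form** (the shape the f-sum stiffness word needs at a thermal target): `U_P·t'_A = (2U_P − U_A)·t'_P` makes the
apex hopping `2t'_P`, so a `T = 0` floor `ℓ ≤ e_{Φ(t,2t'_P,0)}` on the ground-state class at `A` gives
`ℓ − U_A·(2H_b(n/2)/β)/(U_P − U_A) ≤ e_{Φ(t,2t'_P,0)}(ω_P)` on the thermal class at `P`. [cite: KomaTasaki1994, §1] [cite: ScalapinoWhiteZhang1993, §II] -/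
theorem IsTorusLimitOfMixture.le_meanEnergy_twice_tPrime_thermal_of_forall_groundSource (t : ℝ) {t'A t'P UA UP : ℝ}
    (hUA : 0 ≤ UA) (hU : UA < UP) (hapex : UP * t'A = (2 * UP - UA) * t'P) (hn0 : 0 ≤ n) (hn2 : n < 2)
    {β : ℝ} (hβ : 0 < β) {ℓ : ℝ}
    (hℓ : ∀ (ωA : InfVolFermionState 2) (LsA : ℕ → ℕ) (ψA : ∀ L, Fock (Orb (FermionTorus 2 L))),
      Tendsto LsA atTop atTop →
      (∀ j, IsGroundStateInSector (hubbardTorusTT' (LsA j) t t'A UA) (rectN n (LsA j)) 0 (ψA (LsA j))) →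
      (∀ j, star (ψA (LsA j)) ⬝ᵥ ψA (LsA j) = 1) → ωA.IsTorusLimitOf ψA LsA →
      ℓ ≤ ωA.meanEnergy (hubbardTTPrimeFermionInteraction t (2 * t'P) 0) 1)
    {ωP : InfVolFermionState 2} {LsP : ℕ → ℕ}
    (hP : ωP.IsTorusLimitOfMixture (sectorGibbsCount n) (fun L => sectorGibbsWeightTT' β t t'P UP n L)
      (fun L => sectorGibbsVectorTT' t t'P UP n L) LsP)
    (hLsP : Tendsto LsP atTop atTop) :
    ℓ - UA * (2 * Real.binEntropy (n / 2) / β) / (UP - UA) ≤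
      ωP.meanEnergy (hubbardTTPrimeFermionInteraction t (2 * t'P) 0) 1 := by
  have hd : UP - UA ≠ 0 := (sub_pos.2 hU).ne'
  have hκ : (UP * t'A - UA * t'P) / (UP - UA) = 2 * t'P := by
    rw [div_eq_iff hd, hapex]; ring
  have h := IsTorusLimitOfMixture.le_meanEnergy_apexHopping_thermal_of_forall_groundSource t t'A t'P hUA hU hn0 hn2 hβ
    (ℓ := ℓ) (by rw [hκ]; exact hℓ) hP hLsP
  rwa [hκ] at h

/-- **The `t' = 0` ray** (`κ = 0`): a `T = 0` floor `ℓ ≤ e_{Φ(t,0,0)}` (kinetic energy per site) on the ground-state class at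
`(t, 0, U_A, n)` gives `ℓ − U_A·(2H_b(n/2)/β)/(U_P − U_A) ≤ e_{Φ(t,0,0)}(ω_P)` on the thermal class at `(β; t, 0, U_P, n)` for every
`U_P > U_A` — a certified `T = 0` kinetic word at `U_A` is a thermal kinetic word at every larger `U` and every temperature.
[cite: KomaTasaki1994, §1] [cite: Ruelle1969, §2.5] -/
theorem IsTorusLimitOfMixture.le_meanEnergy_kinetic_tPrime_zero_thermal_of_forall_groundSource (t : ℝ) {UA UP : ℝ}
    (hUA : 0 ≤ UA) (hU : UA < UP) (hn0 : 0 ≤ n) (hn2 : n < 2) {β : ℝ} (hβ : 0 < β) {ℓ : ℝ}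
    (hℓ : ∀ (ωA : InfVolFermionState 2) (LsA : ℕ → ℕ) (ψA : ∀ L, Fock (Orb (FermionTorus 2 L))),
      Tendsto LsA atTop atTop →
      (∀ j, IsGroundStateInSector (hubbardTorusTT' (LsA j) t 0 UA) (rectN n (LsA j)) 0 (ψA (LsA j))) →
      (∀ j, star (ψA (LsA j)) ⬝ᵥ ψA (LsA j) = 1) → ωA.IsTorusLimitOf ψA LsA →
      ℓ ≤ ωA.meanEnergy (hubbardTTPrimeFermionInteraction t 0 0) 1)
    {ωP : InfVolFermionState 2} {LsP : ℕ → ℕ}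
    (hP : ωP.IsTorusLimitOfMixture (sectorGibbsCount n) (fun L => sectorGibbsWeightTT' β t 0 UP n L)
      (fun L => sectorGibbsVectorTT' t 0 UP n L) LsP)
    (hLsP : Tendsto LsP atTop atTop) :
    ℓ - UA * (2 * Real.binEntropy (n / 2) / β) / (UP - UA) ≤
      ωP.meanEnergy (hubbardTTPrimeFermionInteraction t 0 0) 1 := by
  have h := IsTorusLimitOfMixture.le_meanEnergy_twice_tPrime_thermal_of_forall_groundSource t (t'A := 0) (t'P := 0)
    hUA hU (by ring) hn0 hn2 hβ (ℓ := ℓ) (by simpa only [mul_zero] using hℓ) hP hLsP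
  simpa only [mul_zero] using h

end InfVolFermionState

end Literature.MathematicalPhysics.QuantumLattice

end
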